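import Literature.AnabelianGeometry.AbsoluteAnabelian.GaloisPadicLogPadicUnits
import Literature.IUT.LogVolume.PadicSubfields
import HarnessLib

/-!
# `log_k̄(𝒪_{k(x)}^×)` is `p`-adically separated: `⋂_m p^m · log_k̄(𝒪_{k(x)}^×) = 0` (proof-only)

S. Mochizuki, *Topics in absolute anabelian geometry III*, §3, Def. 3.1 (iv) p. 69 [MochizukiAbsTopIII2015] (the
pre-log-shell `log_k̄(𝒪_k^×)`, a LATTICE — in particular a bounded, hence `p`-adically separated, `ℤ_p`-submodule of
`k`); *Inter-universal Teichmüller theory II*, §1, Example 1.8 (iv) p. 39 [claim: Mochizuki2012, status: disputed]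
(IUTchII §1 Ex 1.8 (iv), kurims p.39 l.8–10) ("for each open subgroup `H ⊆ G`, preserve the “lattice” in
`O^{×μ}(G)^H` determined by the image of `O^×(G)^H` [i.e., where the superscript “`H`” denotes the submodule of
`H`-invariants]"; only the AbsTopIII-side separatedness of the pre-log-shell is modelled here — `O^{×μ}` is not used).
abc-iut cell, seat abc-iut-L6-d2 (gen 5), by-name input for the rows «ZHAT-NAT» (abc-iut-w5-d149: `ℚ_p`-linearity of
the lifts on `k~`) and «ZHAT-COMPARE» (the `Ẑ^×`-powers on `O^×` induce the `ℤ_p^×`-powers on `O^{×μ}`).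

* `PadicAlgCl.eq_zero_of_forall_eq_pow_mul_log` — in `ℚ̄_p`: if `d = p^m · log_p(u_m)` for every `m` with units `u_m`
  of ONE finite `E ⊆ ℚ̄_p`, then `d = 0` (abc-iut-S1's `isCompact_logUnits`: `log_p(𝒪_E^×)` is compact, hence bounded,
  and `‖p^m‖ → 0`);
* `MLFClosure.eq_zero_of_forall_eq_pow_mul_log_adjoin(_ofResidueChar)` — the same for THE logarithm `log_k̄` of an
  abstract `MLFClosure` `(k, k̄)` and the units of `k(x) ⊆ k̄` (`x ∈ k̄` arbitrary), transported BY RFL through the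
  definition of `MLFClosure.galoisPadicLogOfResidueChar` along `k̄ ≃ₐ[k] ℚ̄_p`.

HONEST FRAMING: classical `p`-adic analysis; nothing here bears on [IUTchIII] Cor. 3.12.
-/

set_option autoImplicit false

noncomputable section

open scoped Literature.IUT.LogVolume

namespace Literature.NumberTheory.GaloisRepresentations

open Literature.NumberTheory.Transcendental Literature.IUT.LogVolume

/-- **`log_p(𝒪_E^×)` is `p`-adically separated inside `ℚ̄_p`**: if `d ∈ ℚ̄_p` is, for every `m`, of the form
`p^m · log_p(u_m)` with `u_m` a unit of one fixed finite extension `E ⊆ ℚ̄_p` of `ℚ_p`, then `d = 0` (`log_p(𝒪_E^×)` is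
compact, hence bounded). [cite: MochizukiAbsTopIII2015, Definition 3.1 (iv) p.69] -/
theorem PadicAlgCl.eq_zero_of_forall_eq_pow_mul_log (p : ℕ) [Fact p.Prime]
    (E : IntermediateField ℚ_[p] (PadicAlgCl p)) [FiniteDimensional ℚ_[p] E] (d : PadicAlgCl p)
    (hd : ∀ m : ℕ, ∃ u : PadicAlgCl p, u ∈ E ∧ ‖u‖ = 1 ∧ d = (p : PadicAlgCl p) ^ m * padicLogAlgCl p u) :
    d = 0 := by
  obtain ⟨B, hB⟩ := (isCompact_logUnits p E).isBounded.exists_norm_le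
  have hp1 : (1 : ℝ) < p := by exact_mod_cast (Fact.out : p.Prime).one_lt
  have hnp : ‖(p : PadicAlgCl p)‖ = (p : ℝ)⁻¹ := by
    rw [← map_natCast (algebraMap ℚ_[p] (PadicAlgCl p)), norm_algebraMap', Padic.norm_p]
  -- `‖d‖ ≤ p^{-m} · B` for every `m`
  have hbound : ∀ m : ℕ, ‖d‖ ≤ ((p : ℝ)⁻¹) ^ m * B := by
    intro m
    obtain ⟨u, huE, hu1, hdu⟩ := hd m
    have hu1' : ‖(⟨u, huE⟩ : E)‖ = 1 := hu1
    have hmem : (unitLog (⟨u, huE⟩ : E) : E) ∈ logUnits E := mem_logUnits_iff.mpr ⟨⟨u, huE⟩, hu1', rfl⟩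
    have hle := hB _ hmem
    change ‖((unitLog (⟨u, huE⟩ : E) : E) : PadicAlgCl p)‖ ≤ B at hle
    rw [coe_unitLog_eq_padicLogAlgCl p E hu1'] at hle
    rw [hdu, norm_mul, norm_pow, hnp]
    exact mul_le_mul_of_nonneg_left hle (pow_nonneg (inv_nonneg.mpr (Nat.cast_nonneg p)) m)
  by_contra hd0
  have hdpos : 0 < ‖d‖ := norm_pos_iff.mpr hd0
  have hB0 : 0 ≤ B := le_trans (norm_nonneg _) (le_trans (hbound 0) (by rw [pow_zero, one_mul]))
  -- choose `m` with `p^{-m} · (B + 1) < ‖d‖`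
  obtain ⟨m, hm⟩ := exists_pow_lt_of_lt_one (div_pos hdpos (by linarith : (0 : ℝ) < B + 1))
    (inv_lt_one_of_one_lt₀ hp1)
  have h1 := hbound m
  have h2 : ((p : ℝ)⁻¹) ^ m * B ≤ ((p : ℝ)⁻¹) ^ m * (B + 1) :=
    mul_le_mul_of_nonneg_left (by linarith) (pow_nonneg (inv_nonneg.mpr (Nat.cast_nonneg p)) m)
  have h3 : ((p : ℝ)⁻¹) ^ m * (B + 1) < ‖d‖ := by
    have := mul_lt_mul_of_pos_right hm (by linarith : (0 : ℝ) < B + 1)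
    rwa [div_mul_cancel₀ _ (by linarith : (B + 1 : ℝ) ≠ 0)] at this
  linarith

end Literature.NumberTheory.GaloisRepresentations

namespace Literature.AnabelianGeometry.AbsoluteAnabelian

open ValuativeRel
open scoped ValuativeRel
open Literature.NumberTheory.Transcendental Literature.NumberTheory.GaloisRepresentations

namespace MLFClosure

variable (C : MLFClosure.{0})

/-- **`⋂_m p^m · log_k̄(𝒪_{k(x)}^×) = 0` at a residue characteristic `p`** (abstract closure `(k, k̄)`, `x ∈ k̄`): if
`d = p^m · log_k̄(y_m)` for every `m` with units `y_m ∈ 𝒪_k̄^× ∩ k(x)`, then `d = 0` — transport of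
`PadicAlgCl.eq_zero_of_forall_eq_pow_mul_log` along `k̄ ≃ₐ[k] ℚ̄_p` at the finite level `k(x̂) ⊆ ℚ̄_p`.
[cite: MochizukiAbsTopIII2015, Definition 3.1 (iv) p.69] -/
theorem eq_zero_of_forall_eq_pow_mul_log_adjoin_ofResidueChar (p : ℕ) [Fact p.Prime]
    (hpk : valuation C.k p < 1) (x d : C.K)
    (hd : ∀ m : ℕ, ∃ y : C.K, y ∈ IntermediateField.adjoin C.k ({x} : Set C.K) ∧ y ∈ unitSubmonoid C.k C.K ∧
      d = (p : C.K) ^ m * (C.galoisPadicLogOfResidueChar p hpk).log y) :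
    d = 0 := by
  letI iQk : Algebra ℚ_[p] C.k := LocalField.padicAlgebra C.k p hpk
  letI iQK : Algebra ℚ_[p] C.K := ((algebraMap C.k C.K).comp (LocalField.padicRingHom C.k p hpk)).toAlgebra
  haveI : IsScalarTower ℚ_[p] C.k C.K := IsScalarTower.of_algebraMap_eq fun _ => rfl
  haveI : FiniteDimensional ℚ_[p] C.k :=
    Literature.NumberTheory.PAdicHodge.PadicBase.instFiniteDimensional (F := C.k) (p := p) hpk
  haveI : IsAlgClosure ℚ_[p] C.K :=
    { isAlgClosed := IsAlgClosure.isAlgClosed C.k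
      isAlgebraic := C.isAlgebraic_padic_K p hpk }
  let e : C.K ≃ₐ[ℚ_[p]] PadicAlgCl p := IsAlgClosure.equiv ℚ_[p] C.K (PadicAlgCl p)
  letI ikA : Algebra C.k (PadicAlgCl p) := (e.toAlgHom.toRingHom.comp (algebraMap C.k C.K)).toAlgebra
  haveI hST : IsScalarTower ℚ_[p] C.k (PadicAlgCl p) := IsScalarTower.of_algebraMap_eq fun c => by
    change algebraMap ℚ_[p] (PadicAlgCl p) c = e (algebraMap C.k C.K (algebraMap ℚ_[p] C.k c))
    rw [← IsScalarTower.algebraMap_apply ℚ_[p] C.k C.K, AlgEquiv.commutes]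
  let e' : C.K ≃ₐ[C.k] PadicAlgCl p :=
    { e.toRingEquiv with commutes' := fun _ => rfl }
  have hlog : ∀ z : C.K, (C.galoisPadicLogOfResidueChar p hpk).log z = e'.symm (padicLogAlgCl p (e' z)) :=
    fun _ => rfl
  -- the finite level `k(x̂) ⊆ ℚ̄_p`, as an intermediate field over `ℚ_p`
  haveI : Algebra.IsAlgebraic C.k (PadicAlgCl p) := PadicAlgCl.isAlgebraic_of_tower p
  let F : IntermediateField C.k (PadicAlgCl p) := IntermediateField.adjoin C.k ({e' x} : Set (PadicAlgCl p))
  haveI hF : FiniteDimensional C.k F :=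
    IntermediateField.adjoin.finiteDimensional (Algebra.IsAlgebraic.isAlgebraic (e' x)).isIntegral
  haveI hF' : FiniteDimensional ℚ_[p] F := Module.Finite.trans C.k F
  let E : IntermediateField ℚ_[p] (PadicAlgCl p) := F.restrictScalars ℚ_[p]
  haveI : FiniteDimensional ℚ_[p] E := hF'
  -- transport `d`
  have hed : ∀ m : ℕ, ∃ u : PadicAlgCl p, u ∈ E ∧ ‖u‖ = 1 ∧ e' d = (p : PadicAlgCl p) ^ m * padicLogAlgCl p u := by
    intro m
    obtain ⟨y, hyF, hyU, hdy⟩ := hd m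
    refine ⟨e' y, ?_, ?_, ?_⟩
    · change e' y ∈ F
      have hmap : y ∈ (IntermediateField.adjoin C.k ({x} : Set C.K)) := hyF
      have : e' y ∈ (((IntermediateField.adjoin C.k ({x} : Set C.K)).map (e' : C.K →ₐ[C.k] PadicAlgCl p) :
          IntermediateField C.k (PadicAlgCl p)) : Set (PadicAlgCl p)) := by
        rw [IntermediateField.coe_map]
        exact ⟨y, hmap, rfl⟩
      rw [IntermediateField.adjoin_map, Set.image_singleton, SetLike.mem_coe] at this
      exact this
    · rw [← mem_unitSubmonoid_iff_norm_eq_one_of_isNonarchimedeanLocalField p (k := C.k)]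
      exact (mem_unitSubmonoid_algEquiv_iff e' y).mpr hyU
    · rw [hdy, map_mul, map_pow, map_natCast, hlog, AlgEquiv.apply_symm_apply]
  have h0 := PadicAlgCl.eq_zero_of_forall_eq_pow_mul_log p E (e' d) hed
  exact (map_eq_zero_iff e' e'.injective).mp h0

variable [Fact C.residueChar.Prime]

/-- **`⋂_m p^m · log_k̄(𝒪_{k(x)}^×) = 0` for THE residue characteristic `p`** (`MLFClosure.galoisPadicLog`,
`MLFClosure.padicScalar`): if `d = p^m · log_k̄(y_m)` for every `m`, with units `y_m ∈ 𝒪_k̄^× ∩ k(x)`, then `d = 0`.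
[cite: MochizukiAbsTopIII2015, Definition 3.1 (iv) p.69] -/
theorem eq_zero_of_forall_eq_pow_mul_log_adjoin (x d : C.K)
    (hd : ∀ m : ℕ, ∃ y : C.K, y ∈ IntermediateField.adjoin C.k ({x} : Set C.K) ∧ y ∈ unitSubmonoid C.k C.K ∧
      d = (C.residueChar : C.K) ^ m * C.galoisPadicLog.log y) :
    d = 0 :=
  C.eq_zero_of_forall_eq_pow_mul_log_adjoin_ofResidueChar C.residueChar C.valuation_ringChar_lt_one x d hd

end MLFClosure

end Literature.AnabelianGeometry.AbsoluteAnabelian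

end
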